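import Summits.Ventures.HSemireg.AmplificationChainG2n
import Summits.Ventures.HSemireg.ContractionRankPartialFourier
import Summits.Ventures.HSemireg.FormulaNUniformLaw
import Summits.Ventures.HSemireg.FormulaNUniformCarrier
import Summits.Ventures.HSemireg.CensusG8Verdict
import Summits.Ventures.HSemireg.TwelvefoldDoor
import HarnessLib

/-!
# Venture HSemireg — STRUCTURE §2 (S1)/(S2)/(S4) ⟹ §3.0 «THE LADDER», kernel form at level `g = 2N`, WIRED to the Sunday typers' files:
# an EXTREMAL secant box (`dim Ext²(E,E) ≤ r(P, ch E) = boxRank N 2 = [t²] P_N(t)²`, EVALUATED from the class shape, every `N ≥ 2`) on the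
# SPLIT component `(N, K = ℚ(√-d))` ⟹ the Weil classes of every split `√-d`-Weil `2N`-fold and of EVERY `√-d`-Weil `2n`-fold, `n < N`, are
# algebraic — modulo the named transfer assumption and Deligne's reach; the readings by `g` of the SIGNED verdict; § g = 8 as ONE conjunction

HONEST FRAMING. Lean index of the computation cell `pub-hsemireg` (seat p11, «Sunday typer — assembly, g = 2n», file 2/2; companion of
`AmplificationChainG2n.lean`; written from the SIGNED `target-g6/VERDICT-G6.md` v1.0 `1651dcc7322662a2` and `general-structure/STRUCTURE.md`
v1.0-SIGNED). NOTHING about any explicit variety is asserted; every published input is a hypothesis BY NAME, every object, frame and number a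
hypothesis BY VALUE; nothing here says HC, HC_CM or HC_AV is proved. STRUCTURE's (S1)–(S3) are seat-proved CLASS-LEVEL laws (typed uniformly in `n` by
seat p10: `FormulaNUniform*.lean`), (S4) is the OPEN existence clause, and the signed verdict records NO such object on any deciding component
(«NO-in-families-tried» at `g = 6` non-split and at `g = 8`; «STRUCTURAL-NO not claimed»). Every theorem below is an IMPLICATION whose object-side
hypotheses no census row discharges; 0 `sorry`, 0 `def`, 0 new named fact; proofs compose landed theorems of seats p4, p5, p6, p7, p9, p10, p11 and the
Hodge summit's Weil ladder.

## What is typed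

§1 THE STRUCTURE THEOREM AT `g = 2N`, UNIFORMLY FOR EVERY `N ≥ 2` (`ladder_of_reach_of_perfectComplexRankTransfer_of_extremalBox`). STRUCTURE §1/§2
   identify the column «`dim Ext²(E,E)`» of a BOX `E = Φ(F ⊠ F′)(⊗ M)` of two transversal 2-secant factors as `R₂(n) = rank ⌟ch(E) = [t²] P_n(t)²`
   (`18, 48, 88, 140, …`; (S1), th-7 Σ1–Σ3 + GS C4) — in the kernel: seat p10's `boxRank n 2` and `contractionRank_pointPairBox_eq_boxRank` (the
   point-pair box on the REAL carriers, every `n ≥ 2`), moved to the census frame by seat p4's partial-Fourier transport and seat p6's twist invariance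
   (`contractionRank_eq_boxRank_of_partialFourier` below) — and (S2) says `δ_E := dim Ext² − R₂(n) = 0` ⟹ `σ_E` injective (th-7 Σ4/Σ5; p10's
   `s2_saturation` is its linear-algebra shape; the identification `σ ∘ c = ⌟ch` is [BuchweitzFlenner2008HH] Prop. 6.4.4 ON PAPER). In the kernel the
   two meet in p4's rank door: the admissibility clause `rank Ext²(E,E) ≤ r(P, ch E)` with `r` EVALUATED reads «`dim Ext²(E,E) ≤ boxRank N 2`» =
   «`E` is EXTREMAL» ((S4)'s word). THE THEOREM: BY NAME `weilFamilyReach_hyperbolic` (Deligne, REFEREED) and `PerfectComplexRankTransfer C`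
   (ASSUMPTION of the venture — its (S2) leg BF 2008 Prop. 6.4.4 and the transfer of a complex Perry 2022 Prop. 8.1 / Pridham 2024 Cor. 2.25 are
   printed content ON PAPER; no kernel link, F-1); BY VALUE an extremal box of that shape with Markman's class data on a SPLIT `√-d`-Weil `2N`-fold
   ⟹ `Stubs.WeilAlgebraicSplitHyperplane N d ∧ ∀ 2 ≤ n < N, WeilAlgebraicAll n d` — STRUCTURE §3.0 verbatim («… YES (ladder)»), all lower levels by
   Schoen's descent (PROVED in the tree), through seat p11's landed `ladder_of_reach_of_perfectComplexRankTransfer_of_complex`. At `N = 2` this is the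
   STEP-0 row with `r = 18` (p4's `weilFourfoldsSplit_of_reach_of_perfectComplexRankTransfer_of_extRank_eq_of_partialFourier`); at `N = 3` the split
   sixfold method instances (`r = 48`; the theta-secant row is seat p8's `MethodInstanceG6ThetaSecant.lean`); §1b spells the bound as the numeral
   `6N² − 2N` for `N ≥ 3`.
§2 READINGS BY `g` OF THE SIGNED VERDICT (bundled seeds `HasHyperbolicSeedOn 𝒪 N d`, door-agnostic): `N = 3` — the `g = 6` SPLIT METHOD
   INSTANCES would give split sixfolds AND `WeilAlgebraicAll 2 d` ([Markman2025SecantWeil] Thm. 1.5.1 / Cor. 1.6.1, re-derived — in print; the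
   theta-secant `d` of record is `m² − 1 ∈ {3, 15, 35, 63, 99}`; the re-indexing `63 ↦ 7`, `99 ↦ 11` to the squarefree field parameter is seat p8's
   follow-up file `MethodInstanceG6ThetaSecantCells.lean`); `N = 4` — § g = 8; `N = 5` —
   § g = 10 / (S4)'s first rung; STRUCTURE (S1)–(S4)'s n-PATTERN in p10's spelling `SaturationLawShape E` for the kernel existence predicate
   `E N := ∀ d > 0, HasHyperbolicSeedOn 𝒪 N d`: its `record` field (levels 2, 3) ⟹ Markman's fourfold statement F1 re-derived; its `conjecture`
   field = `S4Conjecture E` ⟹ R∞ `WeilClassesImaginaryQuadratic` and, with Moonen–Zarhin BY NAME, p5's ladder conjunction — NOT `HC_AV`; its first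
   new rung `n = 6` ⟹ «all Weil-type abelian varieties of dim ≤ 10 with field `K`» through the S4-PUSH cell's `TwelvefoldDoor.lean` (s4-bridge-1).
§3 § g = 8 as ONE conjunction: seat p9's CERTIFIED NEGATIVE over the census of record as kernel data (`CensusG8.outcome_g8`) ∧ the conditional a
   passing row WOULD have instantiated (`N = 4` ⟹ every sixfold cell of its `K`).

References: [BuchweitzFlenner2008HH] Prop. 6.4.4; [BuchweitzFlenner2003] Def. 4.1, §5; [Perry2022] Prop. 8.1; [Pridham2024Semiregularity]
Cor. 2.25, Rem. 2.27; [Mukai1981] Thm. 2.2; [Orlov2002DerivedAbelian] Assertion 2.8; [MumfordAV1970] §1 (4), §4 (iii); [Deligne1982HodgeCycles]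
proof of Thm. 4.8; [Schoen1998HodgeWeilAddendum] §10; [Markman2025SecantWeil] arXiv:2502.03415 Thm. 1.5.1, Cor. 1.6.1 (preprint);
[Markman2025SurveySecant] arXiv:2509.23403 §4, §11.5, §12, Thm. 1.2, Cor. 1.3; [Markman2023GeneralizedKummers] JEMS 25 (2023) Thm. 1.5 (= 13.4);
[MoonenZarhin1999LowDim] Thms. 0.1–0.2; [Weil1977HodgeRing] §3.
-/

noncomputable section

open CategoryTheory AlgebraicGeometry Set
open CliffordAlgebra (contractLeft)
open ExteriorAlgebra (ι)
open Module
open Literature.AlgebraicGeometry Literature.AlgebraicGeometry.Motives Literature.AlgebraicGeometry.HodgeTheory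
open Literature.AlgebraicGeometry.ModuliOfAbelianVarieties Literature.AlgebraicGeometry.Deligne1982
open Literature.AlgebraicGeometry.KTheory Literature.AlgebraicGeometry.VanGeemen1994
open Literature.AlgebraicTopology.SingularHomology

namespace Summit.Ventures.HSemireg

open Summit.HodgeConjecture.HodgeConjecture
open Summit.HodgeConjecture.HodgeConjecture.WeilTypeLadder
open Summit.HodgeConjecture.HodgeConjecture.Cruxes.HodgeAbelianVarieties.EStepSecantInduction
open Summit.HodgeConjecture.HodgeConjecture.Ring2.Hypotheses
open Summit.HodgeConjecture.HodgeConjecture.Ring2.AbelianAll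
open Summit.Ventures.HSemireg.GeneralStructure
open Summit.Ventures.HSemireg.FormulaN.Uniform (boxRank boxRank_two S4Conjecture SaturationLawShape)

/-! ## §1 THE STRUCTURE THEOREM at `g = 2N`, uniformly for `N ≥ 2`: an EXTREMAL box of T4a/UNTWIST shape on the split component ⟹ the ladder -/

section Structure

variable {C : ChernCharacterBetti}
variable {V₁ V₂ : Type} [AddCommGroup V₁] [Module ℂ V₁] [AddCommGroup V₂] [Module ℂ V₂] [FiniteDimensional ℂ V₂]
variable {kV : ℕ} (b₂ : Module.Basis (Fin kV) ℂ V₂) (L₁ : Submodule ℂ V₁) (L₂ : Submodule ℂ V₂)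
variable {Asrc P' : AbelianVariety ℂ} {W₁ W₂ M₁ M₂ : Submodule ℂ (complexBetti Asrc.X 1)}

/-- **(S1) in the kernel, every level: `r(P, κ'') = boxRank N 2 = [t²] P_N(t)²` for the T4a/UNTWIST class shape** (`18` at `N = 2`, `6N² − 2N`
for `N ≥ 3`): seat p10's `contractionRank_pointPairBox_eq_boxRank` (the point-pair box `(a₁ + b₁ω₁) ∧ (a₂ + b₂ω₂)` on the REAL carriers of p4's rank
door, any `N ≥ 2`) on the SOURCE `2N`-fold, moved to the target by p4's `contractionRank_eq_of_partialFourier_transport` (`Φ = id × Φ_𝒫`,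
identifications `g, g', hL, hL', hF` BY VALUE) and p6's twist invariance `contractionRank_eq_of_totalExteriorClass_eq_mul_expSum` (`⊗ M`, `htw` BY
VALUE). [cite: BuchweitzFlenner2008HH, Prop. 6.4.4] [cite: Mukai1981, Thm. 2.2] [cite: MumfordAV1970, §1 (4) and §4 (iii)] -/
theorem contractionRank_eq_boxRank_of_partialFourier (hA : IsSmoothProjective Asrc.dim Asrc.X)
    (κ : ∀ p : ℕ, complexBetti Asrc.X (2 * p)) (κ' κ'' : ∀ p : ℕ, complexBetti P'.X (2 * p)) {m : ℕ} (hm : 2 ≤ m)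
    (hW : IsCompl W₁ W₂) (hW₁ : Module.finrank ℂ W₁ = 2 * m) (hW₂ : Module.finrank ℂ W₂ = 2 * m)
    (hM : hodgeZeroOne hA = M₁ ⊔ M₂) (hM₁ : M₁ ≤ W₁) (hM₂ : M₂ ≤ W₂)
    (hm₁ : Module.finrank ℂ M₁ = m) (hm₂ : Module.finrank ℂ M₂ = m)
    {ω₁ : ExteriorAlgebra ℂ W₁} (hω₁ : ω₁ ∈ ⋀[ℂ]^(2 * m) W₁) (hω₁0 : ω₁ ≠ 0)
    {ω₂ : ExteriorAlgebra ℂ W₂} (hω₂ : ω₂ ∈ ⋀[ℂ]^(2 * m) W₂) (hω₂0 : ω₂ ≠ 0)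
    {a₁ b₁ a₂ b₂' : ℂ} (ha₁ : a₁ ≠ 0) (hb₁ : b₁ ≠ 0) (ha₂ : a₂ ≠ 0) (hb₂ : b₂' ≠ 0)
    (hbox : totalExteriorClass Asrc κ =
      ExteriorAlgebra.map W₁.subtype (algebraMap ℂ _ a₁ + b₁ • ω₁) * ExteriorAlgebra.map W₂.subtype (algebraMap ℂ _ a₂ + b₂' • ω₂))
    (g : complexBetti Asrc.X 1 ≃ₗ[ℂ] V₁ × V₂) (g' : complexBetti P'.X 1 ≃ₗ[ℂ] V₁ × Module.Dual ℂ V₂)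
    (hL : ⇑g '' hodgeZeroOneSet Asrc = (L₁.prod L₂ : Set (V₁ × V₂)))
    (hL' : ⇑g' '' hodgeZeroOneSet P' = (L₁.prod L₂.dualAnnihilator : Set (V₁ × Module.Dual ℂ V₂)))
    (hF : ExteriorAlgebra.map g'.toLinearMap (totalExteriorClass P' κ') =
      ContractionSpan.partialFourier b₂ (ExteriorAlgebra.map g.toLinearMap (totalExteriorClass Asrc κ)))
    {c : ExteriorAlgebra ℂ (complexBetti P'.X 1)}
    (hc : c ∈ Submodule.span ℂ {z : ExteriorAlgebra ℂ (complexBetti P'.X 1) |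
      ∃ v : complexBetti P'.X 1, ∃ q ∈ hodgeZeroOneSet P', z = ι ℂ v * ι ℂ q}) {Nc : ℕ} (hNc : c ^ Nc = 0)
    (htw : totalExteriorClass P' κ'' = totalExteriorClass P' κ' * ∑ k ∈ Finset.range Nc, ((k.factorial : ℂ)⁻¹) • c ^ k) :
    contractionRank P' κ'' = ((boxRank m 2 : ℕ) : Cardinal) := by
  rw [contractionRank_eq_of_totalExteriorClass_eq_mul_expSum P' hc hNc htw,
    contractionRank_eq_of_partialFourier_transport b₂ L₁ L₂ Asrc P' κ κ' g g' hL hL' hF]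
  exact contractionRank_pointPairBox_eq_boxRank hA κ hm hW hW₁ hW₂ hM hM₁ hM₂ hm₁ hm₂ hω₁ hω₁0 hω₂ hω₂0 ha₁ hb₁ ha₂ hb₂ hbox

/-- **THE STRUCTURE THEOREM AT `g = 2N`, every `N ≥ 2` — STRUCTURE (S1)+(S2)+(S4) ⟹ §3.0 «THE LADDER», kernel form, every binder a real
carrier.** BY NAME: `weilFamilyReach_hyperbolic` (Deligne, REFEREED tree fact) and `PerfectComplexRankTransfer C` (the venture's ASSUMPTION for
seat p4's real rank class; printed content ON PAPER: [BuchweitzFlenner2008HH] Prop. 6.4.4 — whence «`dim Ext² ≤ r` ⟹ `σ_E` injective», STRUCTURE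
(S2) — and [Perry2022] Prop. 8.1 / [Pridham2024Semiregularity] Cor. 2.25 + Rem. 2.27 / [Lieblich2006] for the transfer of a perfect complex; the
kernel links it to none of these, F-1). BY VALUE: the split anchor — a complex abelian `2N`-fold `P` with `ψ₀ ≫ ψ₀ = -d`, of SPLIT Weil type for
`h_K = symmetrisedClass d P ψ₀ e a`, a non-zero rational Weil class `w`; the object — a bounded complex of vector bundles `E` on `P.X`,
`I ⊇ {1, …, 2N}`, Chern data `ch_N(E) = q·h_Kᴺ + w`, `ch_p(E) = c_p·h_Kᵖ` off `N` (Markman's class shape), its `Ext` clauses stated on a SOURCE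
object `G` over `Y₀` (what the engines compute: `Ext^{<0} = 0`, `Hom = ℂ`) with `extRank P.X E m = extRank Y₀ G m` for `m ≤ 2`, and the
EXTREMALITY clause **`dim Ext²(G,G) ≤ boxRank N 2`** (`= [t²] P_N(t)²`: `18, 48, 88, 140, …`); the class SHAPE that evaluates `r(P, ch E)` — the
point-pair BOX on a source `2N`-fold `Asrc` (`ch(I_p ⊠ I_q)`, possibly sheared), its PARTIAL FOURIER transport to `P` and the TWIST by `e^{c}`
(`⊗ M`), exactly the binders of `contractionRank_eq_boxRank_of_partialFourier`. CONCLUSION: (i) `Stubs.WeilAlgebraicSplitHyperplane N d` — EVERY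
split `√-d`-Weil `2N`-fold; (ii) `∀ 2 ≤ n < N, WeilAlgebraicAll n d` — EVERY `√-d`-Weil `2n`-fold below, every discriminant class (Schoen's descent
PROVED in the tree, iterated). `N = 2`: the STEP-0 row (g = 4 YES as METHOD INSTANCE; in print [Markman2023GeneralizedKummers] Thm. 1.5); `N = 3`:
the split sixfold method instances; `N ≥ 4`: an implication with no printed instance and — by the SIGNED verdict — no census object ((S3): none
expected at `N ≡ 0 (mod 4)`; (S4): conjectured at `N = 5` and `N ≡ 2 (mod 4)`).
[cite: BuchweitzFlenner2008HH, Prop. 6.4.4] [cite: Perry2022, Prop. 8.1] [cite: Pridham2024Semiregularity, Cor. 2.25, Rem. 2.27]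
[cite: Mukai1981, Thm. 2.2] [cite: Orlov2002DerivedAbelian, Assertion 2.8] [cite: Deligne1982HodgeCycles, proof of Thm. 4.8]
[cite: Schoen1998HodgeWeilAddendum, §10] [cite: Markman2023GeneralizedKummers, Theorem 1.5 (= Theorem 13.4), p. 236 (the N = 2 case in print; arXiv:1805.11574 pre-publication numbering: Theorem 1.3)]
[cite: Markman2025SurveySecant, §4, §11.5 and §12 (preprint)] -/
theorem ladder_of_reach_of_perfectComplexRankTransfer_of_extremalBox
    (hF' : weilFamilyReach_hyperbolic) (hT : PerfectComplexRankTransfer C) {N d : ℕ} (hN : 2 ≤ N) (hd : 0 < d)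
    (P : AbelianVariety ℂ) (ψ₀ : P ⟶ P) (e : ProjectiveEmbedding P.X) (a : complexBetti (projectiveSpace e.n ℂ) 2)
    (hP : P.dim = 2 * N) (hψ : ψ₀ ≫ ψ₀ = -(d • 𝟙 P)) (ha : IsRationalClass a) (ha0 : a ≠ 0)
    (hhyp : IsHyperbolicWeilType P ψ₀ N (symmetrisedClass d P ψ₀ e a))
    (w : complexBetti P.X (2 * N)) (hwW : w ∈ weilClassesOf P ψ₀ N d) (hwr : IsRationalClass w) (hw0 : w ≠ 0)
    (I : Finset ℕ) (hI : ∀ p : ℕ, 1 ≤ p → p ≤ 2 * N → p ∈ I) (E : CochainComplex P.X.left.Modules ℤ)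
    (hE : IsBoundedVBComplex E) (q : ℚ) (cq : ℕ → ℚ)
    (hchN : chPerfect C P.X E hE.isFiniteLocallyFree N = ((q : ℚ) : ℂ) • cupPowTwo (symmetrisedClass d P ψ₀ e a) N + w)
    (hchp : ∀ p ∈ I, p ≠ N →
      chPerfect C P.X E hE.isFiniteLocallyFree p = ((cq p : ℚ) : ℂ) • cupPowTwo (symmetrisedClass d P ψ₀ e a) p)
    -- the `Ext` clauses on a SOURCE object and the EXTREMALITY clause (BY VALUE)
    {Y₀ : SchemeOver ℂ} (G : CochainComplex Y₀.left.Modules ℤ)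
    (hext : ∀ m : ℤ, m ≤ 2 → extRank P.X E m = extRank Y₀ G m)
    (hneg : ∀ k : ℤ, k < 0 → extRank Y₀ G k = 0) (h0 : extRank Y₀ G 0 = 1)
    (h2 : extRank Y₀ G 2 ≤ ((boxRank N 2 : ℕ) : Cardinal))
    -- the class SHAPE evaluating `r(P, ch E) = boxRank N 2` (BY VALUE): the source box …
    (hAsrc : IsSmoothProjective Asrc.dim Asrc.X) (κs : ∀ p : ℕ, complexBetti Asrc.X (2 * p))
    (hW : IsCompl W₁ W₂) (hW₁ : Module.finrank ℂ W₁ = 2 * N) (hW₂ : Module.finrank ℂ W₂ = 2 * N)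
    (hM : hodgeZeroOne hAsrc = M₁ ⊔ M₂) (hM₁ : M₁ ≤ W₁) (hM₂ : M₂ ≤ W₂)
    (hm₁ : Module.finrank ℂ M₁ = N) (hm₂ : Module.finrank ℂ M₂ = N)
    {ω₁ : ExteriorAlgebra ℂ W₁} (hω₁ : ω₁ ∈ ⋀[ℂ]^(2 * N) W₁) (hω₁0 : ω₁ ≠ 0)
    {ω₂ : ExteriorAlgebra ℂ W₂} (hω₂ : ω₂ ∈ ⋀[ℂ]^(2 * N) W₂) (hω₂0 : ω₂ ≠ 0)
    {a₁ b₁ a₂ b₂' : ℂ} (ha₁ : a₁ ≠ 0) (hb₁ : b₁ ≠ 0) (ha₂ : a₂ ≠ 0) (hb₂ : b₂' ≠ 0)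
    (hbox : totalExteriorClass Asrc κs =
      ExteriorAlgebra.map W₁.subtype (algebraMap ℂ _ a₁ + b₁ • ω₁) * ExteriorAlgebra.map W₂.subtype (algebraMap ℂ _ a₂ + b₂' • ω₂))
    -- … its partial Fourier transport to `P`, and the twist
    (κ₀ : ∀ p : ℕ, complexBetti P.X (2 * p))
    (g : complexBetti Asrc.X 1 ≃ₗ[ℂ] V₁ × V₂) (g' : complexBetti P.X 1 ≃ₗ[ℂ] V₁ × Module.Dual ℂ V₂)
    (hL : ⇑g '' hodgeZeroOneSet Asrc = (L₁.prod L₂ : Set (V₁ × V₂)))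
    (hL' : ⇑g' '' hodgeZeroOneSet P = (L₁.prod L₂.dualAnnihilator : Set (V₁ × Module.Dual ℂ V₂)))
    (hF : ExteriorAlgebra.map g'.toLinearMap (totalExteriorClass P κ₀) =
      ContractionSpan.partialFourier b₂ (ExteriorAlgebra.map g.toLinearMap (totalExteriorClass Asrc κs)))
    {c : ExteriorAlgebra ℂ (complexBetti P.X 1)}
    (hc : c ∈ Submodule.span ℂ {z : ExteriorAlgebra ℂ (complexBetti P.X 1) |
      ∃ v : complexBetti P.X 1, ∃ q ∈ hodgeZeroOneSet P, z = ι ℂ v * ι ℂ q}) {Nc : ℕ} (hNc : c ^ Nc = 0)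
    (htw : totalExteriorClass P (fun p ↦ chPerfect C P.X E hE.isFiniteLocallyFree p) =
      totalExteriorClass P κ₀ * ∑ k ∈ Finset.range Nc, ((k.factorial : ℂ)⁻¹) • c ^ k) :
    Stubs.WeilAlgebraicSplitHyperplane N d ∧ ∀ n : ℕ, 2 ≤ n → n < N → WeilAlgebraicAll n d := by
  -- (S1): the contraction rank of the class shape, EVALUATED in the kernel
  have hr : contractionRank P (fun p ↦ chPerfect C P.X E hE.isFiniteLocallyFree p) = ((boxRank N 2 : ℕ) : Cardinal) :=
    contractionRank_eq_boxRank_of_partialFourier b₂ L₁ L₂ hAsrc κs κ₀ _ hN hW hW₁ hW₂ hM hM₁ hM₂ hm₁ hm₂ hω₁ hω₁0 hω₂ hω₂0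
      ha₁ hb₁ ha₂ hb₂ hbox g g' hL hL' hF hc hNc htw
  -- (S2)/(S4): extremality feeds the rank door's admissibility clause
  have h2' : extRank Y₀ G 2 ≤ Cardinal.lift.{1} (contractionRank P fun p ↦ chPerfect C P.X E hE.isFiniteLocallyFree p) := by
    rw [hr, Cardinal.lift_natCast]
    exact h2
  -- §3.0: split `2N`-folds and the ladder below, through the landed level-`N` census-row theorem (`AmplificationChainG2n.lean` §2)
  exact ladder_of_reach_of_perfectComplexRankTransfer_of_complex hF' hT (by omega) hd P ψ₀ e a hP hψ ha ha0 hhyp w hwW hwr hw0 I hI E hE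
    (fun k hk ↦ (hext k (by omega)).trans (hneg k hk)) ((hext 0 (by norm_num)).trans h0) ((hext 2 le_rfl).symm ▸ h2') q cq hchN hchp

end Structure

/-! ## §1b The bound as a numeral: `boxRank N 2 = 6N² − 2N` for `N ≥ 3` (and `18` at `N = 2`) -/

section Numeral

/-- **Two spellings of STRUCTURE §1's identified column**: for `N ≥ 3` the numeral `6N² − 2N` IS seat p10's `boxRank N 2` (`boxRank_two`:
`boxRank n 2 + 2n = 6n²`); at `N = 2` the value is `18` (the `−4C(n,2) + 2`-type coincidence corrections of the closed form, p10's `nTable_degree_two`).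
[cite: BuchweitzFlenner2008HH, Prop. 6.4.4 (the contraction rank it names)] -/
theorem six_mul_sq_sub_two_mul_eq_boxRank_two {N : ℕ} (hN : 3 ≤ N) : 6 * N ^ 2 - 2 * N = boxRank N 2 := by
  have h := boxRank_two hN
  omega

/-- `boxRank 2 2 = 18` — the g = 4 anchor value of the census (`r = 18`), p10's closed form evaluated. [cite: BuchweitzFlenner2008HH, Prop. 6.4.4] -/
theorem boxRank_two_two : boxRank 2 2 = 18 := by
  decide

end Numeral

/-! ## §2 Readings by `g` of the SIGNED verdict (bundled seeds, door-agnostic; `𝒪 = rankObjClass C`, `sigmaObjClass C`, … by `.localVariationalHodgeFor`) -/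

section Readings

variable {𝒪 : ObjClass}

/-- **`N = 3` — what a `g = 6` SPLIT-component pass gives (VERDICT-G6 v1.0 V-4 «METHOD INSTANCES»: theta-secant `E_m ⊗ M` rows, `rank 48 = bound
48` ×4, `d = m² − 1`; triangle sheaf C13-8; the theta-secant row itself is seat p8's `MethodInstanceG6ThetaSecant.lean`)**: BY NAME hyperbolic reach and
`LocalVariationalHodgeFor 𝒪`; BY VALUE ONE hyperbolic seed of class `𝒪` on a split `√-d`-Weil SIXFOLD ⟹ (i) every split `√-d`-Weil sixfold
(`Stubs.WeilAlgebraicSplitHyperplane 3 d`; [Markman2025SecantWeil] Thm. 1.5.1, preprint — RE-DERIVED), (ii) EVERY `√-d`-Weil abelian FOURFOLD, every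
discriminant (`WeilAlgebraicAll 2 d`; [Markman2025SecantWeil] Cor. 1.6.1 / [Markman2025SurveySecant] Thm. 1.2 for that `K` — in print, re-derived), (iii)
every fourfold cell. No new case is claimed. [cite: Markman2025SecantWeil, Thm. 1.5.1 and Cor. 1.6.1 (preprint)] [cite: Markman2025SurveySecant, Thm. 1.2 and §11.5 Step 2 (preprint)]
[cite: Schoen1998HodgeWeilAddendum, §10] [cite: Deligne1982HodgeCycles, proof of Thm. 4.8] -/
theorem sixfoldSplit_and_fourfolds_of_reach_of_localVariationalHodgeFor_of_hyperbolicSeedOn_three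
    (hF : weilFamilyReach_hyperbolic) (hT : LocalVariationalHodgeFor 𝒪) {d : ℕ} (hd : 0 < d) (hS : HasHyperbolicSeedOn 𝒪 3 d) :
    Stubs.WeilAlgebraicSplitHyperplane 3 d ∧ WeilAlgebraicAll 2 d ∧ ∀ δ : weilNormResidueGroup d, WeilClassesComponent 2 d δ :=
  have h2 : WeilAlgebraicAll 2 d :=
    weilAlgebraicAll_of_localVariationalHodgeFor_of_hyperbolicSeedOn_lt hF hT hS (le_refl 2) (by norm_num) hd
  ⟨splitHyperplane_of_reach_of_localVariationalHodgeFor_of_hyperbolicSeedOn hF (by norm_num) hd hT hS, h2,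
    fun δ ↦ weilClassesComponent_of_weilAlgebraicAll h2 δ⟩

/-- **`N = 4` — what a `g = 8` pass would give (VERDICT-G6 v1.0 § g = 8: «NO-in-families-tried», every row deciding, candidates 0; STRUCTURE (S3)
MOD-4 LAW: no G-semiregular secant design at `n ≡ 0 (mod 4)`)**: ONE hyperbolic seed of class `𝒪` on a split `√-d`-Weil EIGHTFOLD ⟹ every split
eightfold ∧ EVERY `√-d`-Weil sixfold and fourfold, every discriminant ∧ every sixfold cell `(3, d, δ)` (the deciding `g = 6` cells included). An
implication with no printed instance ([Markman2025SurveySecant] §12, an expectation) and no census object; companions: p5's `MarkmanClassStatementTower.lean` §1.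
[cite: Markman2025SurveySecant, §11.5 Steps 1–2 and §12 (preprint)] [cite: Schoen1998HodgeWeilAddendum, §10] [cite: Deligne1982HodgeCycles, proof of Thm. 4.8] -/
theorem eightfoldSplit_and_below_of_reach_of_localVariationalHodgeFor_of_hyperbolicSeedOn_four
    (hF : weilFamilyReach_hyperbolic) (hT : LocalVariationalHodgeFor 𝒪) {d : ℕ} (hd : 0 < d) (hS : HasHyperbolicSeedOn 𝒪 4 d) :
    Stubs.WeilAlgebraicSplitHyperplane 4 d ∧ WeilAlgebraicAll 3 d ∧ WeilAlgebraicAll 2 d ∧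
      ∀ δ : weilNormResidueGroup d, WeilClassesComponent 3 d δ :=
  have h3 : WeilAlgebraicAll 3 d :=
    weilAlgebraicAll_of_localVariationalHodgeFor_of_hyperbolicSeedOn_lt hF hT hS (by norm_num) (by norm_num) hd
  ⟨splitHyperplane_of_reach_of_localVariationalHodgeFor_of_hyperbolicSeedOn hF (by norm_num) hd hT hS, h3,
    weilAlgebraicAll_of_localVariationalHodgeFor_of_hyperbolicSeedOn_lt hF hT hS (le_refl 2) (by norm_num) hd,
    fun δ ↦ weilClassesComponent_of_weilAlgebraicAll h3 δ⟩

/-- **`N = 5` — what a `g = 10` pass would give (VERDICT-G6 v1.0 § g = 10 appendix: «family S, `n = 5`: no witness»; STRUCTURE (S4): the `n = 5`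
rung is the FIRST place an extremal class-alive secant factor is expected — direct route `rank ev₃ = e₂^G`, or the Prym door)**: ONE hyperbolic seed of
class `𝒪` on a split `√-d`-Weil TENFOLD ⟹ every split `√-d`-Weil tenfold ∧ EVERY `√-d`-Weil eightfold, sixfold and fourfold, every discriminant (the
cell's DOOR #2 in any door currency; p3's `TenfoldDoor.lean` is the `d = 1` sheaf-door case). No printed instance, no census object.
[cite: Markman2025SurveySecant, §4 and §12 (preprint)] [cite: Schoen1998HodgeWeilAddendum, §10] [cite: Deligne1982HodgeCycles, proof of Thm. 4.8] -/
theorem tenfoldSplit_and_below_of_reach_of_localVariationalHodgeFor_of_hyperbolicSeedOn_five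
    (hF : weilFamilyReach_hyperbolic) (hT : LocalVariationalHodgeFor 𝒪) {d : ℕ} (hd : 0 < d) (hS : HasHyperbolicSeedOn 𝒪 5 d) :
    Stubs.WeilAlgebraicSplitHyperplane 5 d ∧ WeilAlgebraicAll 4 d ∧ WeilAlgebraicAll 3 d ∧ WeilAlgebraicAll 2 d :=
  ⟨splitHyperplane_of_reach_of_localVariationalHodgeFor_of_hyperbolicSeedOn hF (by norm_num) hd hT hS,
    weilAlgebraicAll_of_localVariationalHodgeFor_of_hyperbolicSeedOn_lt hF hT hS (by norm_num) (by norm_num) hd,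
    weilAlgebraicAll_of_localVariationalHodgeFor_of_hyperbolicSeedOn_lt hF hT hS (by norm_num) (by norm_num) hd,
    weilAlgebraicAll_of_localVariationalHodgeFor_of_hyperbolicSeedOn_lt hF hT hS (le_refl 2) (by norm_num) hd⟩


/-- **Member reading below the seed level** (the writer's sentence): BY NAME hyperbolic reach and `LocalVariationalHodgeFor 𝒪`; BY VALUE ONE hyperbolic
seed of class `𝒪` at level `N` for `K = ℚ(√-d)` ⟹ for every `2 ≤ n < N` and EVERY `(A, φ)` of Weil type `(n, d)` (van Geemen 4.9; any discriminant,
CM or not) the WHOLE complexified Weil plane is algebraic: `weilClassesOf A φ n d ≤ algebraicClasses A.X n` (p5's member reading of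
`WeilAlgebraicAll n d`). [cite: vanGeemen1994HodgeAV, 4.9–4.10 and Lemma 5.2] [cite: Schoen1998HodgeWeilAddendum, §10]
[cite: Deligne1982HodgeCycles, proof of Thm. 4.8] -/
theorem weilClassesOf_le_algebraicClasses_lt_of_reach_of_localVariationalHodgeFor_of_hyperbolicSeedOn
    (hF : weilFamilyReach_hyperbolic) (hT : LocalVariationalHodgeFor 𝒪) {N d : ℕ} (hd : 0 < d) (hS : HasHyperbolicSeedOn 𝒪 N d)
    {n : ℕ} (hn : 2 ≤ n) (hnN : n < N) {A : AbelianVariety ℂ} {φ : A ⟶ A} (hA : IsWeilType A φ n d) :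
    weilClassesOf A φ n d ≤ algebraicClasses A.X n :=
  weilClassesOf_le_algebraicClasses_of_weilAlgebraicAll_of_isWeilType
    (weilAlgebraicAll_of_localVariationalHodgeFor_of_hyperbolicSeedOn_lt hF hT hS hn hnN hd) hA

/-- **STRUCTURE (S4) in seat p10's spelling, read as a hypothesis: `S4Conjecture E := E 5 ∧ ∀ n ≥ 6, n % 4 = 2 → E n` for the kernel existence
predicate `E N := ∀ d > 0, HasHyperbolicSeedOn 𝒪 N d`** (ONE hyperbolic seed of class `𝒪` on a split `√-d`-Weil `2N`-fold for every `d` — the kernel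
currency of «extremal class-alive secant factors, hence semiregular class-exact boxes on the split component `(n, K, (−1)ⁿ·Nm)`, EXIST at level `n`»).
The levels `N ≡ 2 (mod 4)`, `N ≥ 6`, are COFINAL, so (S4) ∧ hyperbolic reach ∧ `LocalVariationalHodgeFor 𝒪` ⟹ R∞ `WeilClassesImaginaryQuadratic`
(Weil 1977's question for imaginary quadratic `K`; Schoen descent PROVED in the tree). (S4) is the structure's OPEN CONJECTURE — nothing is claimed;
this is what it would buy; NOT `HC_AV`. [cite: Weil1977HodgeRing, §3] [cite: Markman2025SurveySecant, §4 and §12 (preprint)]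
[cite: Schoen1998HodgeWeilAddendum, §10] [cite: Deligne1982HodgeCycles, proof of Thm. 4.8] -/
theorem weilClassesImaginaryQuadratic_of_s4Conjecture_of_reach_of_localVariationalHodgeFor (hF : weilFamilyReach_hyperbolic)
    (hT : LocalVariationalHodgeFor 𝒪) (hS4 : S4Conjecture fun N ↦ ∀ d : ℕ, 0 < d → HasHyperbolicSeedOn 𝒪 N d) :
    WeilClassesImaginaryQuadratic :=
  weilClassesImaginaryQuadratic_of_reach_of_localVariationalHodgeFor_of_cofinalHyperbolicSeedsOn hF hT fun n hn d hd ↦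
    ⟨4 * n + 2, by omega, hS4.2 (4 * n + 2) (by omega) (by omega) d hd⟩

/-- **(S4)'s `n = 5` conjunct ⟹ every split `√-d`-Weil tenfold and EVERY `√-d`-Weil eightfold, sixfold and fourfold, for every `d`** — the § g = 10
reading. [cite: Markman2025SurveySecant, §4 and §12 (preprint)] [cite: Schoen1998HodgeWeilAddendum, §10] -/
theorem tenfoldSplit_and_below_of_s4Conjecture_of_reach_of_localVariationalHodgeFor (hF : weilFamilyReach_hyperbolic)
    (hT : LocalVariationalHodgeFor 𝒪) (hS4 : S4Conjecture fun N ↦ ∀ d : ℕ, 0 < d → HasHyperbolicSeedOn 𝒪 N d) {d : ℕ} (hd : 0 < d) :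
    Stubs.WeilAlgebraicSplitHyperplane 5 d ∧ WeilAlgebraicAll 4 d ∧ WeilAlgebraicAll 3 d ∧ WeilAlgebraicAll 2 d :=
  tenfoldSplit_and_below_of_reach_of_localVariationalHodgeFor_of_hyperbolicSeedOn_five hF hT hd (hS4.1 d hd)


/-- **(S4)'s first new rung `n = 6`** — STRUCTURE §2 (S4) v0.25 verbatim: «a semiregular class-exact secant box on the SPLIT `(6, K)` component of Weil
12-folds would, by the ladder, give the Weil classes on all Weil-type abelian varieties of dim ≤ 10 with field `K` (incl. K1's non-split sixfolds)» —
in p10's spelling the `n = 6` instance of `S4Conjecture E` (`6 % 4 = 2`), fed to the S4-PUSH cell's level-6 door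
`TwelvefoldDoor.weilAlgebraicAll_le_five_of_reach_of_localVariationalHodgeFor_of_hyperbolicSeedOn_six` (seat s4-bridge-1): for every `d`,
`WeilAlgebraicAll 5 d ∧ 4 d ∧ 3 d ∧ 2 d`. Nothing claimed: (S4) is open. [cite: Markman2025SurveySecant, §4 and §12 (preprint)] [cite: Schoen1998HodgeWeilAddendum, §10] -/
theorem weilAlgebraicAll_le_five_of_s4Conjecture_of_reach_of_localVariationalHodgeFor (hF : weilFamilyReach_hyperbolic)
    (hT : LocalVariationalHodgeFor 𝒪) (hS4 : S4Conjecture fun N ↦ ∀ d : ℕ, 0 < d → HasHyperbolicSeedOn 𝒪 N d) {d : ℕ} (hd : 0 < d) :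
    WeilAlgebraicAll 5 d ∧ WeilAlgebraicAll 4 d ∧ WeilAlgebraicAll 3 d ∧ WeilAlgebraicAll 2 d :=
  weilAlgebraicAll_le_five_of_reach_of_localVariationalHodgeFor_of_hyperbolicSeedOn_six hF hT hd (hS4.2 6 (by norm_num) (by norm_num) d hd)

/-- **(S4) with the Moonen–Zarhin reduction BY NAME ⟹ the whole «consequences» column of p5's tower**: R∞ ∧ F1 (Markman's fourfold statement,
re-derived) ∧ R1 = stmt-2524 (`WeilSixfolds`) ∧ R1′ (`NonsplitSixfolds`) ∧ R2 (`SplitWeilAbelianVarieties`) ∧ HC(dim ≤ 5) ([Markman2025SurveySecant]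
Cor. 1.3 AS PRINTED, as an implication). NOT `HC_AV`. [cite: Markman2025SurveySecant, Thm. 1.2, Cor. 1.3 and §12 (preprint)]
[cite: MoonenZarhin1999LowDim, Thm. 0.1 and Thm. 0.2] [cite: Weil1977HodgeRing, §3] -/
theorem ladder_of_moonenZarhin_of_s4Conjecture_of_reach_of_localVariationalHodgeFor
    (hMZ : MoonenZarhin1999_hodgeClasses_abelian_dim_le_five_of_weilClassesFourfolds) (hF : weilFamilyReach_hyperbolic)
    (hT : LocalVariationalHodgeFor 𝒪) (hS4 : S4Conjecture fun N ↦ ∀ d : ℕ, 0 < d → HasHyperbolicSeedOn 𝒪 N d) :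
    WeilClassesImaginaryQuadratic ∧ Markman2025_weilClasses_algebraic_abelianFourfold ∧ Theses.SevenfoldWeilCensus.WeilSixfolds ∧
      NonsplitSixfolds ∧ SplitWeilAbelianVarieties ∧ Theses.SevenfoldWeilCensus.HodgeAbelianDimLeFive :=
  ladder_of_moonenZarhin_of_reach_of_localVariationalHodgeFor_of_cofinalHyperbolicSeedsOn hMZ hF hT fun n hn d hd ↦
    ⟨4 * n + 2, by omega, hS4.2 (4 * n + 2) (by omega) (by omega) d hd⟩

/-- **The «OF RECORD» field of p10's `SaturationLawShape E` (levels `2` and `3`: `E 2 ∧ E 3`) ⟹ Markman's FOURFOLD statement F1 re-derived**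
(`Markman2025_weilClasses_algebraic_abelianFourfold`: every `K`, every discriminant — from the level-`3` seeds alone, by p5's
`floorFourfolds_of_reach_of_localVariationalHodgeFor_of_hyperbolicSeedsOn_three`; in print, not new), and its `conjecture` field ⟹ R∞ as above. The
shape's `exclusion` field ((S3)) carries no positive consequence. [cite: Markman2025SurveySecant, Thm. 1.2 and §11.5 Step 2 (preprint)]
[cite: Markman2025SecantWeil, §1.6, proof of Cor. 1.6.1, first sentence (preprint)] [cite: Weil1977HodgeRing, §3] -/
theorem floorFourfolds_and_weilClassesImaginaryQuadratic_of_saturationLawShape (hF : weilFamilyReach_hyperbolic)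
    (hT : LocalVariationalHodgeFor 𝒪) (hS : SaturationLawShape fun N ↦ ∀ d : ℕ, 0 < d → HasHyperbolicSeedOn 𝒪 N d) :
    Markman2025_weilClasses_algebraic_abelianFourfold ∧ WeilClassesImaginaryQuadratic :=
  ⟨floorFourfolds_of_reach_of_localVariationalHodgeFor_of_hyperbolicSeedsOn_three hF hT hS.record.2,
    weilClassesImaginaryQuadratic_of_s4Conjecture_of_reach_of_localVariationalHodgeFor hF hT hS.conjecture⟩

end Readings

section RouteC

variable {C : ChernCharacterBetti}

/-- **Route (C), rank door: (S4) in p10's spelling ⟹ R∞** (p4's `PerfectComplexRankTransfer C` BY NAME — ASSUMPTION, F-1; seeds of the real rank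
class `rankObjClass C`, i.e. rank-admissible bounded complexes of vector bundles with Markman's class shape, BY VALUE).
[cite: BuchweitzFlenner2008HH, Prop. 6.4.4] [cite: Weil1977HodgeRing, §3] [cite: Markman2025SurveySecant, §4 and §12 (preprint)] -/
theorem weilClassesImaginaryQuadratic_of_s4Conjecture_of_reach_of_perfectComplexRankTransfer (hF : weilFamilyReach_hyperbolic)
    (hT : PerfectComplexRankTransfer C) (hS4 : S4Conjecture fun N ↦ ∀ d : ℕ, 0 < d → HasHyperbolicSeedOn (rankObjClass C) N d) :
    WeilClassesImaginaryQuadratic :=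
  weilClassesImaginaryQuadratic_of_s4Conjecture_of_reach_of_localVariationalHodgeFor hF hT.localVariationalHodgeFor hS4

/-- **Route (C), σ-door: (S4) in p10's spelling ⟹ R∞** (t-7's `PerfectComplexSigmaTransfer C` BY NAME — ASSUMPTION; seeds of `sigmaObjClass C`,
i.e. `I`-semiregular strictly perfect complexes with Markman's class shape, BY VALUE). [claim: Perry2026Semiregularity, status: under-review]
[cite: BuchweitzFlenner2003, Def. 4.1 and §5 (I-semiregular)] [cite: Weil1977HodgeRing, §3] -/
theorem weilClassesImaginaryQuadratic_of_s4Conjecture_of_reach_of_perfectComplexSigmaTransfer (hF : weilFamilyReach_hyperbolic)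
    (hT : PerfectComplexSigmaTransfer C) (hS4 : S4Conjecture fun N ↦ ∀ d : ℕ, 0 < d → HasHyperbolicSeedOn (sigmaObjClass C) N d) :
    WeilClassesImaginaryQuadratic :=
  weilClassesImaginaryQuadratic_of_s4Conjecture_of_reach_of_localVariationalHodgeFor hF hT.localVariationalHodgeFor hS4

end RouteC

/-! ## §3 § g = 8 of the SIGNED verdict, WIRED: the certified negative (seat p9's census-as-kernel-data) ∧ the conditional a pass would give -/

section G8

variable {𝒪 : ObjClass}

/-- **§ g = 8 as ONE conjunction.** (a) Seat p9's CERTIFIED NEGATIVE STATEMENT over the `g = 8` census of record transcribed as kernel data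
(`CensusG8.census`, target-g8/CENSUS.md v1.273; `CensusG8Verdict.lean`): the coordinator's three-outcome form, as a FUNCTION of the table, evaluates
to «NO-in-families-tried» — no row at `n = 4` is both CLASS-EXACT and SEMIREGULAR, and no all-object barrier row exists (so NOT «STRUCTURAL-NO»);
(b) what ONE passing row WOULD have given — BY NAME hyperbolic reach and `LocalVariationalHodgeFor 𝒪` (for route (C): `PerfectComplexRankTransfer C`
via `.localVariationalHodgeFor`), BY VALUE a hyperbolic seed of class `𝒪` on a split `√-d`-Weil EIGHTFOLD: every split eightfold ∧ every
`√-d`-Weil sixfold and fourfold, every discriminant ∧ every sixfold cell `(3, d, δ)` — the deciding `g = 6` rows included. The data half is a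
statement about the census table, not about varieties; the conditional half asserts nothing about any object.
[cite: Markman2025SurveySecant, §11.5 Steps 1–2 and §12 (preprint)] [cite: Schoen1998HodgeWeilAddendum, §10] [cite: Deligne1982HodgeCycles, proof of Thm. 4.8] -/
theorem g8_noInFamiliesTried_and_conditional (hF : weilFamilyReach_hyperbolic) (hT : LocalVariationalHodgeFor 𝒪) :
    CensusG8.outcome CensusG8.census = .noInFamiliesTried ∧
      ∀ d : ℕ, 0 < d → HasHyperbolicSeedOn 𝒪 4 d →
        Stubs.WeilAlgebraicSplitHyperplane 4 d ∧ WeilAlgebraicAll 3 d ∧ WeilAlgebraicAll 2 d ∧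
          ∀ δ : weilNormResidueGroup d, WeilClassesComponent 3 d δ :=
  ⟨CensusG8.outcome_g8, fun _ hd hS ↦ eightfoldSplit_and_below_of_reach_of_localVariationalHodgeFor_of_hyperbolicSeedOn_four hF hT hd hS⟩

end G8

/-! ## Audit: nothing is decided here
§1 carries the SEED by value (object, `Ext` clauses, extremality, Chern data, class-shape frame) and `PerfectComplexRankTransfer C` BY NAME
(assumption; its printed legs — BF 2008 Prop. 6.4.4 = STRUCTURE (S2), Perry / Pridham for the transfer — are not kernel-linked), plus the refereed
reach. §2 reads the signed verdict's rows as the implications they would instantiate; (S4) / the saturation-law shape enter only as hypotheses on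
the kernel existence predicate. §3's data half is p9's `decide` theorem about the transcribed table. `HC_CM`, CM density, Mumford–Tate finiteness do
not occur; the terminus is R∞ / HC(dim ≤ 5) modulo Moonen–Zarhin, NOT `HC_AV`. 0 `def`, 0 named fact, 0 `sorry`. -/

end Summit.Ventures.HSemireg

end
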